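import Summits.CriticalPhenomena.PercolationContinuityZ3.Theorems.PercNearOneGluingNoHeavyLowerTailGZWheatstonePlus

/-!
# `NoHeavyLowerTail` (stmt-CriticalPhenomena-4575) — support file: **THEOREM F** (cell level), the logarithmic covariance
# bound composes across a terminal FAN carrying TWO hub vertices

Support file (`--supports stmt-CriticalPhenomena-4575`; closes nothing; no definitions, no named facts, no sorries),
prover `prim-ineq-prove-2` gen 17, memo `run/shared/lean/prim/prim-ineq-prove-2/THEOREM-F.md`.
Setting: hub `c`, `H = G − c`, terminals `a, b`; `b` has exactly two neighbours `y, z` in `H` (fan edges `b–y` of weight `β₁`,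
`b–z` of weight `β₂`), and the hub edges of `c` go to `y` (weight `g₁`) and `z` (weight `g₂`) only.  `G_a := H − b` is an
ARBITRARY finite weighted graph; it enters only through its three-point connectivity law on `{a, y, z}`:
`τ = P(a~y~z)`, `p₁ = P(a~y, a≁z)`, `p₂ = P(a~z, a≁y)`, `ζ = P(y~z)` (so `P(a~y) = τ + p₁`, `P(a~z) = τ + p₂`).
The two READINGS are the single-hub networks `N₁ = (G_a; a, y; hub g₂ at z)` and `N₂ = (G_a; a, z; hub g₁ at y)`; their cells are
`θ(N₁) = τ+p₁`, `w(N₁) = τ+p₁−g₂τ`, `Cov(N₁) = g₂τ − g₂²(τ+p₂)ζ` (and symmetrically), and the hypotheses `hL₁`, `hL₂` say that they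
satisfy `Cov ≤ w·log(θ/w)`.  The composite `(H; a, b)` has (exact enumeration, memo §1, verified symbolically and by exact brute force
on random graphs) `θ = P(a ~_H b)`, `w = P(a ~_H b, cluster unmarked)`, `u = P(a ≁ c)`, `v = P(b ≁ c)`, `z = P(a ≁ c ∧ b ≁ c)` as in the
statement (`f₁ = β₁(1−β₂)`, `f₂ = (1−β₁)β₂`, `f₁₂ = β₁β₂`, `cᵢ = 1 − gᵢ`).
**`fan2cut_cov_le` (THEOREM F): `z − u·v ≤ w·log(θ/w)`**, i.e. `Cov(1{a~c},1{b~c}) ≤ P(ab|c)·log(P(a ~_H b)/P(ab|c))`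
(Gladkov–Zimin Conj. 6.3 / Gladkov Conj. 10.1 with modulus `w log(1/w)`) for every such `(G; a, b, c)` whose two readings satisfy it —
the first case with TWO hub-bearing units (e.g. the Wheatstone bridge with a subdivided fan edge and hubs at the far bridge vertex and at
the subdividing vertex; types T1, T4, T5, T10 of the n = 6 coverage census).  No realisability constraint on `(τ,p₁,p₂,ζ)` is used.
Proof (memo §2): (E1) the classes of `{a ~_H b}` in which a 'key mark' (a mark on a fan-neighbour joined to `b`) is present carry no
unmarked mass; splitting them off first and applying the log-sum inequality (`GZWheatstonePlus.logsum2`, twice) to the rest gives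
`w log(θ/w) ≥ w log(θ/θ⁺) + f₁c₁·w(N₁)log(θ(N₁)/w(N₁)) + f₂c₂·w(N₂)log(θ(N₂)/w(N₂))`; (E2) `z − uv = f₁c₁Cov(N₁) + f₂c₂Cov(N₂) + R`
(a ring identity) and the hypotheses; (E3) the Padé bound `log(θ/θ⁺) ≥ 2(θ−θ⁺)/(θ+θ⁺)` (`GZParallel.two_mul_mul_le_mul_log`);
(E4) `2w(θ−θ⁺) − R(θ+θ⁺) ≥ 0` (`poly_nonneg`): a quadratic form in `(τ,p₁,p₂)` whose six coefficients are explicit nonnegative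
rational combinations of products of `ζ, 1−ζ`, Bernstein polynomials in `β₁, β₂`, and `g₁^a g₂^b (1−g₁)^c (1−g₂)^d [(g₁−g₂)²]`
(421 atoms, found by exact linear programming; memo §3; one `ring` + `positivity`).
[this work — memo THEOREM-F.md; conjecture: GladkovZimin2024 Conj. 6.3, Gladkov2024 Conj. 10.1]
-/

namespace Summit.CriticalPhenomena.PercolationContinuityZ3.Theorems

namespace GZFanTwoCut

set_option maxRecDepth 4096 in
set_option maxHeartbeats 4000000 in
/-- **The polynomial inequality (E4) of THEOREM F** (memo §2–§3): `2·w·(θ−θ⁺) − R·(θ+θ⁺) ≥ 0` for `τ, p₁, p₂ ≥ 0`,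
`ζ, gᵢ, βᵢ ∈ [0,1]`, where (below, in this order) `2w` = twice the unmarked connection mass, `θ − θ⁺` = connection mass with a key mark,
`R` = residual covariance (first-order key-mark costs + fan-mixture penalty), `θ + θ⁺`, all written in the law variables of memo §1.
Certificate: `2w(θ−θ⁺) − R(θ+θ⁺) = τ²K₂₀₀ + p₁²K₀₂₀ + p₂²K₀₀₂ + τp₁K₁₁₀ + τp₂K₁₀₁ + p₁p₂K₀₁₁` (`ring`) with each `K` an explicit sum of
products of nonnegative factors (`positivity`). -/
theorem poly_nonneg {τ p₁ p₂ ζ g₁ g₂ β₁ β₂ : ℝ}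
    (hτ : 0 ≤ τ) (hp₁ : 0 ≤ p₁) (hp₂ : 0 ≤ p₂)
    (hζ : 0 ≤ ζ) (hζ1 : ζ ≤ 1) (hg₁ : 0 ≤ g₁) (hg₁1 : g₁ ≤ 1) (hg₂ : 0 ≤ g₂) (hg₂1 : g₂ ≤ 1)
    (hβ₁ : 0 ≤ β₁) (hβ₁1 : β₁ ≤ 1) (hβ₂ : 0 ≤ β₂) (hβ₂1 : β₂ ≤ 1) :
    0 ≤ 2 * ((β₁ * (1 - β₂)) * (1 - g₁) * (τ + p₁ - g₂ * τ) + ((1 - β₁) * β₂) * (1 - g₂) * (τ + p₂ - g₁ * τ) + (β₁ * β₂) * (1 - g₁) * (1 - g₂) * (τ + p₁ + p₂)) * ((β₁ * (1 - β₂)) * g₁ * (τ + p₁) + ((1 - β₁) * β₂) * g₂ * (τ + p₂) + (β₁ * β₂) * (1 - (1 - g₁) * (1 - g₂)) * (τ + p₁ + p₂))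
      - ((β₁ * (1 - β₂)) * (1 - g₁) * (τ + p₁ - g₂ * τ) * g₁ * (1 - g₂ * ζ) + ((1 - β₁) * β₂) * (1 - g₂) * (τ + p₂ - g₁ * τ) * g₂ * (1 - g₁ * ζ) + (β₁ * β₂) * (1 - g₁) * (1 - g₂) * (τ + p₁ + p₂) * (1 - (1 - g₁) * (1 - g₂)) + ((β₁ * β₂) * ((1 - g₁) * g₂ * p₁ + g₁ * (1 - g₂) * p₂) * (((1 - β₁) * (1 - β₂)) * (1 - (1 - g₁) * (1 - g₂)) + (1 - ζ) * ((β₁ * (1 - β₂)) * (1 - g₁) * g₂ + ((1 - β₁) * β₂) * (1 - g₂) * g₁))))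
        * (((β₁ * (1 - β₂)) * (τ + p₁) + ((1 - β₁) * β₂) * (τ + p₂) + (β₁ * β₂) * (τ + p₁ + p₂))
           + ((β₁ * (1 - β₂)) * (1 - g₁) * (τ + p₁) + ((1 - β₁) * β₂) * (1 - g₂) * (τ + p₂) + (β₁ * β₂) * (1 - g₁) * (1 - g₂) * (τ + p₁ + p₂))) := by
  have hc₁ : 0 ≤ 1 - g₁ := by linarith
  have hc₂ : 0 ≤ 1 - g₂ := by linarith
  have hb₁ : 0 ≤ 1 - β₁ := by linarith
  have hb₂ : 0 ≤ 1 - β₂ := by linarith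
  have hz : 0 ≤ 1 - ζ := by linarith
  obtain ⟨K200, hK200⟩ : ∃ x : ℝ, x =
          (1 - ζ) * ((1 - β₁) ^ 2 * β₂ ^ 2) * ((1 : ℝ) * (g₂ ^ 2 * (1 - g₁) * (1 - g₂)))
        + (1 - ζ) * ((2 : ℝ) * β₁ * (1 - β₁) * (2 : ℝ) * β₂ * (1 - β₂)) * (((1 : ℝ) / 2) * (g₁ * g₂ * (1 - g₁) * (1 - g₂)))
        + (1 - ζ) * ((2 : ℝ) * β₁ * (1 - β₁) * β₂ ^ 2) * ((1 : ℝ) * (g₂ ^ 2 * (1 - g₁) ^ 2 * (1 - g₂)) + (1 : ℝ) * (g₁ * g₂ * (1 - g₁) * (1 - g₂)))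
        + (1 - ζ) * (β₁ ^ 2 * (1 - β₂) ^ 2) * ((1 : ℝ) * (g₁ ^ 2 * (1 - g₁) * (1 - g₂)))
        + (1 - ζ) * (β₁ ^ 2 * (2 : ℝ) * β₂ * (1 - β₂)) * ((1 : ℝ) * (g₁ * g₂ * (1 - g₁) ^ 2 * (1 - g₂)) + (1 : ℝ) * (g₁ ^ 2 * (1 - g₁) * (1 - g₂)))
        + (1 - ζ) * (β₁ ^ 2 * β₂ ^ 2) * ((1 : ℝ) * (g₂ ^ 2 * (1 - g₁) ^ 3 * (1 - g₂)) + (2 : ℝ) * (g₁ * g₂ * (1 - g₁) ^ 2 * (1 - g₂)) + (1 : ℝ) * (g₁ ^ 2 * (1 - g₁) * (1 - g₂)))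
        + ζ * ((1 - β₁) ^ 2 * β₂ ^ 2) * ((1 : ℝ) * (g₂ ^ 2 * (1 - g₁) ^ 2 * (1 - g₂)) + (2 : ℝ) * (g₁ * g₂ * (1 - g₁) * (1 - g₂)))
        + ζ * ((2 : ℝ) * β₁ * (1 - β₁) * (2 : ℝ) * β₂ * (1 - β₂)) * ((1 : ℝ) * (g₁ * g₂ * (1 - g₁) * (1 - g₂)) + ((1 : ℝ) / 4) * (g₁ * g₂ * (1 - g₁) * (1 - g₂) ^ 2) + ((1 : ℝ) / 4) * (g₁ * g₂ * (1 - g₁) ^ 2 * (1 - g₂)))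
        + ζ * ((2 : ℝ) * β₁ * (1 - β₁) * β₂ ^ 2) * (((1 : ℝ) / 2) * (g₂ ^ 2 * (1 - g₁) ^ 2 * (1 - g₂)) + ((1 : ℝ) / 2) * (g₂ ^ 2 * (1 - g₁) ^ 3 * (1 - g₂)) + ((3 : ℝ) / 2) * (g₁ * g₂ * (1 - g₁) * (1 - g₂)) + ((1 : ℝ) / 2) * (g₁ * g₂ * (1 - g₁) ^ 2 * (1 - g₂)))
        + ζ * (β₁ ^ 2 * (1 - β₂) ^ 2) * ((1 : ℝ) * (g₁ * g₂ * (1 - g₁) * (1 - g₂)) + (1 : ℝ) * (g₁ * g₂ * (1 - g₁) ^ 2 * (1 - g₂)) + (1 : ℝ) * (g₁ ^ 2 * (1 - g₁) * (1 - g₂)))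
        + ζ * (β₁ ^ 2 * (2 : ℝ) * β₂ * (1 - β₂)) * (((1 : ℝ) / 2) * (g₁ * g₂ * (1 - g₁) * (1 - g₂)) + (1 : ℝ) * (g₁ * g₂ * (1 - g₁) ^ 2 * (1 - g₂)) + ((1 : ℝ) / 2) * (g₁ * g₂ * (1 - g₁) ^ 2 * (1 - g₂) ^ 2) + (1 : ℝ) * (g₁ ^ 2 * (1 - g₁) * (1 - g₂)))
        + ζ * (β₁ ^ 2 * β₂ ^ 2) * ((1 : ℝ) * (g₂ ^ 2 * (1 - g₁) ^ 3 * (1 - g₂)) + (2 : ℝ) * (g₁ * g₂ * (1 - g₁) ^ 2 * (1 - g₂)) + (1 : ℝ) * (g₁ ^ 2 * (1 - g₁) * (1 - g₂))) := ⟨_, rfl⟩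
  have hK2000 : 0 ≤ K200 := by rw [hK200]; positivity
  obtain ⟨K020, hK020⟩ : ∃ x : ℝ, x =
          (1 - ζ) * ((3 : ℝ) * β₁ ^ 2 * (1 - β₁) * (1 - β₂) ^ 3) * (((1 : ℝ) / 3) * (g₁ ^ 2 * (1 - g₁)))
        + (1 - ζ) * ((3 : ℝ) * β₁ ^ 2 * (1 - β₁) * (3 : ℝ) * β₂ * (1 - β₂) ^ 2) * (((1 : ℝ) / 9) * (g₁ ^ 2 * (1 - g₁)) + ((2 : ℝ) / 9) * (g₁ ^ 2 * (1 - g₁) * (1 - g₂)))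
        + (1 - ζ) * ((3 : ℝ) * β₁ ^ 2 * (1 - β₁) * (3 : ℝ) * β₂ ^ 2 * (1 - β₂)) * (((1 : ℝ) / 9) * (g₂ ^ 2 * (1 - g₁) ^ 2) + ((2 : ℝ) / 9) * (g₁ ^ 2 * (1 - g₁) * (1 - g₂)) + ((1 : ℝ) / 9) * (g₁ ^ 2 * (1 - g₁) * (1 - g₂) ^ 2))
        + (1 - ζ) * ((3 : ℝ) * β₁ ^ 2 * (1 - β₁) * β₂ ^ 3) * (((1 : ℝ) / 3) * (g₂ ^ 2 * (1 - g₁) ^ 2 * (1 - g₂)) + ((1 : ℝ) / 3) * (g₁ ^ 2 * (1 - g₁) * (1 - g₂) ^ 2))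
        + (1 - ζ) * (β₁ ^ 3 * (1 - β₂) ^ 3) * ((1 : ℝ) * (g₁ ^ 2 * (1 - g₁)))
        + (1 - ζ) * (β₁ ^ 3 * (3 : ℝ) * β₂ * (1 - β₂) ^ 2) * (((2 : ℝ) / 3) * (g₁ * g₂ * (1 - g₁) ^ 2) + ((2 : ℝ) / 3) * (g₁ ^ 2 * (1 - g₁)) + ((1 : ℝ) / 3) * (g₁ ^ 2 * (1 - g₁) * (1 - g₂)))
        + (1 - ζ) * (β₁ ^ 3 * (3 : ℝ) * β₂ ^ 2 * (1 - β₂)) * (((1 : ℝ) / 3) * (g₂ ^ 2 * (1 - g₁) ^ 3) + ((2 : ℝ) / 3) * (g₁ * g₂ * (1 - g₁) ^ 2) + ((2 : ℝ) / 3) * (g₁ * g₂ * (1 - g₁) ^ 2 * (1 - g₂)) + ((1 : ℝ) / 3) * (g₁ ^ 2 * (1 - g₁)) + ((2 : ℝ) / 3) * (g₁ ^ 2 * (1 - g₁) * (1 - g₂)))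
        + (1 - ζ) * (β₁ ^ 3 * β₂ ^ 3) * ((1 : ℝ) * (g₂ ^ 2 * (1 - g₁) ^ 3 * (1 - g₂)) + (2 : ℝ) * (g₁ * g₂ * (1 - g₁) ^ 2 * (1 - g₂)) + (1 : ℝ) * (g₁ ^ 2 * (1 - g₁) * (1 - g₂)))
        + ζ * ((3 : ℝ) * β₁ ^ 2 * (1 - β₁) * (1 - β₂) ^ 3) * (((1 : ℝ) / 3) * (g₁ * g₂ * (1 - g₁)) + ((1 : ℝ) / 3) * (g₁ * g₂ * (1 - g₁) ^ 2) + ((1 : ℝ) / 3) * (g₁ ^ 2 * (1 - g₁)))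
        + ζ * ((3 : ℝ) * β₁ ^ 2 * (1 - β₁) * (3 : ℝ) * β₂ * (1 - β₂) ^ 2) * (((1 : ℝ) / 3) * (g₁ * g₂ * (1 - g₁) ^ 2) + ((1 : ℝ) / 9) * (g₁ * g₂ * (1 - g₁) ^ 2 * (1 - g₂)) + ((1 : ℝ) / 3) * (g₁ ^ 2 * (1 - g₁)))
        + ζ * ((3 : ℝ) * β₁ ^ 2 * (1 - β₁) * (3 : ℝ) * β₂ ^ 2 * (1 - β₂)) * (((1 : ℝ) / 9) * (g₂ ^ 2 * (1 - g₁) ^ 3) + ((2 : ℝ) / 9) * (g₁ * g₂ * (1 - g₁) ^ 2) + ((2 : ℝ) / 9) * (g₁ * g₂ * (1 - g₁) ^ 2 * (1 - g₂)) + ((1 : ℝ) / 9) * (g₁ ^ 2 * (1 - g₁)) + ((2 : ℝ) / 9) * (g₁ ^ 2 * (1 - g₁) * (1 - g₂)))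
        + ζ * ((3 : ℝ) * β₁ ^ 2 * (1 - β₁) * β₂ ^ 3) * (((1 : ℝ) / 3) * (g₂ ^ 2 * (1 - g₁) ^ 3 * (1 - g₂)) + ((2 : ℝ) / 3) * (g₁ * g₂ * (1 - g₁) ^ 2 * (1 - g₂)) + ((1 : ℝ) / 3) * (g₁ ^ 2 * (1 - g₁) * (1 - g₂)))
        + ζ * (β₁ ^ 3 * (1 - β₂) ^ 3) * ((1 : ℝ) * (g₁ * g₂ * (1 - g₁)) + (1 : ℝ) * (g₁ * g₂ * (1 - g₁) ^ 2) + (1 : ℝ) * (g₁ ^ 2 * (1 - g₁)))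
        + ζ * (β₁ ^ 3 * (3 : ℝ) * β₂ * (1 - β₂) ^ 2) * (((2 : ℝ) / 3) * (g₂ ^ 2 * (1 - g₁) ^ 3) + ((1 : ℝ) / 3) * (g₁ * g₂ * (1 - g₁)) + ((5 : ℝ) / 3) * (g₁ * g₂ * (1 - g₁) ^ 2) + (1 : ℝ) * (g₁ ^ 2 * (1 - g₁)))
        + ζ * (β₁ ^ 3 * (3 : ℝ) * β₂ ^ 2 * (1 - β₂)) * (((2 : ℝ) / 3) * (g₂ ^ 2 * (1 - g₁) ^ 3) + ((1 : ℝ) / 3) * (g₂ ^ 2 * (1 - g₁) ^ 3 * (1 - g₂)) + ((4 : ℝ) / 3) * (g₁ * g₂ * (1 - g₁) ^ 2) + ((2 : ℝ) / 3) * (g₁ * g₂ * (1 - g₁) ^ 2 * (1 - g₂)) + ((2 : ℝ) / 3) * (g₁ ^ 2 * (1 - g₁)) + ((1 : ℝ) / 3) * (g₁ ^ 2 * (1 - g₁) * (1 - g₂)))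
        + ζ * (β₁ ^ 3 * β₂ ^ 3) * ((1 : ℝ) * (g₂ ^ 2 * (1 - g₁) ^ 3 * (1 - g₂)) + (2 : ℝ) * (g₁ * g₂ * (1 - g₁) ^ 2 * (1 - g₂)) + (1 : ℝ) * (g₁ ^ 2 * (1 - g₁) * (1 - g₂))) := ⟨_, rfl⟩
  have hK0200 : 0 ≤ K020 := by rw [hK020]; positivity
  obtain ⟨K002, hK002⟩ : ∃ x : ℝ, x =
          (1 - ζ) * ((1 - β₁) ^ 3 * (3 : ℝ) * β₂ ^ 2 * (1 - β₂)) * (((1 : ℝ) / 3) * (g₂ ^ 2 * (1 - g₂)))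
        + (1 - ζ) * ((1 - β₁) ^ 3 * β₂ ^ 3) * ((1 : ℝ) * (g₂ ^ 2 * (1 - g₂)))
        + (1 - ζ) * ((3 : ℝ) * β₁ * (1 - β₁) ^ 2 * (3 : ℝ) * β₂ ^ 2 * (1 - β₂)) * (((1 : ℝ) / 9) * (g₂ ^ 2 * (1 - g₂)) + ((2 : ℝ) / 9) * (g₂ ^ 2 * (1 - g₁) * (1 - g₂)))
        + (1 - ζ) * ((3 : ℝ) * β₁ * (1 - β₁) ^ 2 * β₂ ^ 3) * ((1 : ℝ) * (g₂ ^ 2 * (1 - g₁) * (1 - g₂)) + ((2 : ℝ) / 3) * (g₁ * g₂ * (1 - g₂)))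
        + (1 - ζ) * ((3 : ℝ) * β₁ ^ 2 * (1 - β₁) * (3 : ℝ) * β₂ ^ 2 * (1 - β₂)) * (((2 : ℝ) / 9) * (g₂ ^ 2 * (1 - g₁) * (1 - g₂)) + ((1 : ℝ) / 9) * (g₂ ^ 2 * (1 - g₁) ^ 2 * (1 - g₂)) + ((1 : ℝ) / 9) * (g₁ ^ 2 * (1 - g₂) ^ 2))
        + (1 - ζ) * ((3 : ℝ) * β₁ ^ 2 * (1 - β₁) * β₂ ^ 3) * ((1 : ℝ) * (g₂ ^ 2 * (1 - g₁) ^ 2 * (1 - g₂)) + ((4 : ℝ) / 3) * (g₁ * g₂ * (1 - g₁) * (1 - g₂)) + ((1 : ℝ) / 3) * (g₁ ^ 2 * (1 - g₂)))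
        + (1 - ζ) * (β₁ ^ 3 * (3 : ℝ) * β₂ ^ 2 * (1 - β₂)) * (((1 : ℝ) / 3) * (g₂ ^ 2 * (1 - g₁) ^ 2 * (1 - g₂)) + ((1 : ℝ) / 3) * (g₁ ^ 2 * (1 - g₁) * (1 - g₂) ^ 2))
        + (1 - ζ) * (β₁ ^ 3 * β₂ ^ 3) * ((1 : ℝ) * (g₂ ^ 2 * (1 - g₁) ^ 3 * (1 - g₂)) + (2 : ℝ) * (g₁ * g₂ * (1 - g₁) ^ 2 * (1 - g₂)) + (1 : ℝ) * (g₁ ^ 2 * (1 - g₁) * (1 - g₂)))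
        + ζ * ((1 - β₁) ^ 3 * (3 : ℝ) * β₂ ^ 2 * (1 - β₂)) * (((1 : ℝ) / 3) * (g₂ ^ 2 * (1 - g₁) * (1 - g₂)) + ((2 : ℝ) / 3) * (g₁ * g₂ * (1 - g₂)))
        + ζ * ((1 - β₁) ^ 3 * β₂ ^ 3) * ((1 : ℝ) * (g₂ ^ 2 * (1 - g₁) * (1 - g₂)) + (2 : ℝ) * (g₁ * g₂ * (1 - g₂)))
        + ζ * ((3 : ℝ) * β₁ * (1 - β₁) ^ 2 * (3 : ℝ) * β₂ ^ 2 * (1 - β₂)) * (((2 : ℝ) / 9) * (g₂ ^ 2 * (1 - g₁) * (1 - g₂)) + ((1 : ℝ) / 9) * (g₂ ^ 2 * (1 - g₁) ^ 2 * (1 - g₂)) + ((1 : ℝ) / 3) * (g₁ * g₂ * (1 - g₂)) + ((1 : ℝ) / 9) * (g₁ * g₂ * (1 - g₁) * (1 - g₂)))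
        + ζ * ((3 : ℝ) * β₁ * (1 - β₁) ^ 2 * β₂ ^ 3) * (((1 : ℝ) / 3) * (g₂ ^ 2 * (1 - g₂)) + ((2 : ℝ) / 3) * (g₂ ^ 2 * (1 - g₁) ^ 2 * (1 - g₂)) + ((1 : ℝ) / 3) * (g₁ * g₂ * (1 - g₂)) + ((1 : ℝ) / 3) * (g₁ * g₂ * (1 - g₂) ^ 2) + ((4 : ℝ) / 3) * (g₁ * g₂ * (1 - g₁) * (1 - g₂)) + ((2 : ℝ) / 3) * (g₁ ^ 2 * (1 - g₂)))
        + ζ * ((3 : ℝ) * β₁ ^ 2 * (1 - β₁) * (3 : ℝ) * β₂ ^ 2 * (1 - β₂)) * (((1 : ℝ) / 3) * (g₂ ^ 2 * (1 - g₁) ^ 2 * (1 - g₂)) + ((4 : ℝ) / 9) * (g₁ * g₂ * (1 - g₁) * (1 - g₂)) + ((1 : ℝ) / 9) * (g₁ ^ 2 * (1 - g₂)))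
        + ζ * ((3 : ℝ) * β₁ ^ 2 * (1 - β₁) * β₂ ^ 3) * (((2 : ℝ) / 3) * (g₂ ^ 2 * (1 - g₁) ^ 2 * (1 - g₂)) + ((1 : ℝ) / 3) * (g₂ ^ 2 * (1 - g₁) ^ 3 * (1 - g₂)) + ((4 : ℝ) / 3) * (g₁ * g₂ * (1 - g₁) * (1 - g₂)) + ((2 : ℝ) / 3) * (g₁ * g₂ * (1 - g₁) ^ 2 * (1 - g₂)) + ((2 : ℝ) / 3) * (g₁ ^ 2 * (1 - g₂)) + ((1 : ℝ) / 3) * (g₁ ^ 2 * (1 - g₁) * (1 - g₂)))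
        + ζ * (β₁ ^ 3 * (3 : ℝ) * β₂ ^ 2 * (1 - β₂)) * (((1 : ℝ) / 3) * (g₂ ^ 2 * (1 - g₁) ^ 3 * (1 - g₂)) + ((2 : ℝ) / 3) * (g₁ * g₂ * (1 - g₁) ^ 2 * (1 - g₂)) + ((1 : ℝ) / 3) * (g₁ ^ 2 * (1 - g₁) * (1 - g₂)))
        + ζ * (β₁ ^ 3 * β₂ ^ 3) * ((1 : ℝ) * (g₂ ^ 2 * (1 - g₁) ^ 3 * (1 - g₂)) + (2 : ℝ) * (g₁ * g₂ * (1 - g₁) ^ 2 * (1 - g₂)) + (1 : ℝ) * (g₁ ^ 2 * (1 - g₁) * (1 - g₂))) := ⟨_, rfl⟩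
  have hK0020 : 0 ≤ K002 := by rw [hK002]; positivity
  obtain ⟨K110, hK110⟩ : ∃ x : ℝ, x =
          (1 - ζ) * ((3 : ℝ) * β₁ * (1 - β₁) ^ 2 * (3 : ℝ) * β₂ * (1 - β₂) ^ 2) * (((1 : ℝ) / 9) * (g₂ ^ 2 * (1 - g₁)) + ((1 : ℝ) / 9) * (g₂ ^ 2 * (1 - g₁) ^ 2))
        + (1 - ζ) * ((3 : ℝ) * β₁ * (1 - β₁) ^ 2 * (3 : ℝ) * β₂ ^ 2 * (1 - β₂)) * (((1 : ℝ) / 9) * (g₂ ^ 2 * (1 - g₁) ^ 2) + ((1 : ℝ) / 9) * (g₂ ^ 2 * (1 - g₁) ^ 2 * (1 - g₂)))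
        + (1 - ζ) * ((3 : ℝ) * β₁ * (1 - β₁) ^ 2 * β₂ ^ 3) * (((1 : ℝ) / 3) * (g₂ ^ 2 * (1 - g₁) * (1 - g₂)) + ((1 : ℝ) / 3) * (g₂ ^ 2 * (1 - g₁) ^ 2 * (1 - g₂)))
        + (1 - ζ) * ((3 : ℝ) * β₁ ^ 2 * (1 - β₁) * (1 - β₂) ^ 3) * (((1 : ℝ) / 3) * (g₁ ^ 2 * (1 - g₁)) + ((1 : ℝ) / 3) * (g₁ ^ 2 * (1 - g₁) * (1 - g₂)))
        + (1 - ζ) * ((3 : ℝ) * β₁ ^ 2 * (1 - β₁) * (3 : ℝ) * β₂ * (1 - β₂) ^ 2) * (((2 : ℝ) / 9) * (g₂ ^ 2 * (1 - g₁) ^ 3) + ((1 : ℝ) / 9) * (g₁ * g₂ ^ 2 * (1 - g₁)) + ((2 : ℝ) / 9) * (g₁ * g₂ * (1 - g₁) ^ 2) + ((1 : ℝ) / 9) * (g₁ ^ 2 * (1 - g₁)) + ((5 : ℝ) / 9) * (g₁ ^ 2 * (1 - g₁) * (1 - g₂)))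
        + (1 - ζ) * ((3 : ℝ) * β₁ ^ 2 * (1 - β₁) * (3 : ℝ) * β₂ ^ 2 * (1 - β₂)) * (((1 : ℝ) / 9) * (g₂ ^ 2 * (1 - g₁) ^ 2 * (1 - g₂)) + ((2 : ℝ) / 9) * (g₂ ^ 2 * (1 - g₁) ^ 3) + ((1 : ℝ) / 9) * (g₂ ^ 2 * (1 - g₁) ^ 3 * (1 - g₂)) + ((1 : ℝ) / 3) * (g₁ * g₂ * (1 - g₁) ^ 2) + ((1 : ℝ) / 3) * (g₁ * g₂ * (1 - g₁) ^ 2 * (1 - g₂)) + ((1 : ℝ) / 9) * (g₁ ^ 2 * (1 - g₁)) + ((5 : ℝ) / 9) * (g₁ ^ 2 * (1 - g₁) * (1 - g₂)))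
        + (1 - ζ) * ((3 : ℝ) * β₁ ^ 2 * (1 - β₁) * β₂ ^ 3) * (((1 : ℝ) / 3) * (g₂ ^ 2 * (1 - g₁) * (1 - g₂)) + ((2 : ℝ) / 3) * (g₂ ^ 2 * (1 - g₁) ^ 2 * (1 - g₂)) + ((1 : ℝ) / 3) * (g₂ ^ 2 * (1 - g₁) ^ 3 * (1 - g₂)) + ((1 : ℝ) / 3) * (g₁ * g₂ * (1 - g₁) * (1 - g₂) ^ 2) + (1 : ℝ) * (g₁ * g₂ * (1 - g₁) ^ 2 * (1 - g₂)) + ((2 : ℝ) / 3) * (g₁ ^ 2 * (1 - g₁) * (1 - g₂)))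
        + (1 - ζ) * (β₁ ^ 3 * (1 - β₂) ^ 3) * ((1 : ℝ) * (g₁ ^ 2 * (1 - g₁)) + (1 : ℝ) * (g₁ ^ 2 * (1 - g₁) * (1 - g₂)))
        + (1 - ζ) * (β₁ ^ 3 * (3 : ℝ) * β₂ * (1 - β₂) ^ 2) * (((2 : ℝ) / 3) * (g₁ * g₂ * (1 - g₁) ^ 2) + ((2 : ℝ) / 3) * (g₁ * g₂ * (1 - g₁) ^ 2 * (1 - g₂)) + ((2 : ℝ) / 3) * (g₁ ^ 2 * (1 - g₁)) + ((4 : ℝ) / 3) * (g₁ ^ 2 * (1 - g₁) * (1 - g₂)))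
        + (1 - ζ) * (β₁ ^ 3 * (3 : ℝ) * β₂ ^ 2 * (1 - β₂)) * (((1 : ℝ) / 3) * (g₂ ^ 2 * (1 - g₁) ^ 3) + ((1 : ℝ) / 3) * (g₂ ^ 2 * (1 - g₁) ^ 3 * (1 - g₂)) + ((2 : ℝ) / 3) * (g₁ * g₂ * (1 - g₁) ^ 2) + (2 : ℝ) * (g₁ * g₂ * (1 - g₁) ^ 2 * (1 - g₂)) + ((1 : ℝ) / 3) * (g₁ ^ 2 * (1 - g₁)) + ((5 : ℝ) / 3) * (g₁ ^ 2 * (1 - g₁) * (1 - g₂)))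
        + (1 - ζ) * (β₁ ^ 3 * β₂ ^ 3) * ((2 : ℝ) * (g₂ ^ 2 * (1 - g₁) ^ 3 * (1 - g₂)) + (4 : ℝ) * (g₁ * g₂ * (1 - g₁) ^ 2 * (1 - g₂)) + (2 : ℝ) * (g₁ ^ 2 * (1 - g₁) * (1 - g₂)))
        + ζ * ((3 : ℝ) * β₁ * (1 - β₁) ^ 2 * (3 : ℝ) * β₂ * (1 - β₂) ^ 2) * (((1 : ℝ) / 9) * (g₂ ^ 2 * (1 - g₁) ^ 2) + ((1 : ℝ) / 9) * (g₂ ^ 2 * (1 - g₁) ^ 3) + ((2 : ℝ) / 9) * (g₁ * g₂ * (1 - g₁)) + ((1 : ℝ) / 9) * (g₁ * g₂ * (1 - g₁) * (1 - g₂)) + ((1 : ℝ) / 9) * (g₁ * g₂ * (1 - g₁) ^ 2))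
        + ζ * ((3 : ℝ) * β₁ * (1 - β₁) ^ 2 * (3 : ℝ) * β₂ ^ 2 * (1 - β₂)) * (((1 : ℝ) / 9) * (g₂ ^ 2 * (1 - g₁)) + ((1 : ℝ) / 9) * (g₂ ^ 2 * (1 - g₁) ^ 3 * (1 - g₂)) + ((4 : ℝ) / 9) * (g₁ * g₂ * (1 - g₁) * (1 - g₂)) + ((2 : ℝ) / 9) * (g₁ * g₂ * (1 - g₁) ^ 2 * (1 - g₂)))
        + ζ * ((3 : ℝ) * β₁ * (1 - β₁) ^ 2 * β₂ ^ 3) * (((1 : ℝ) / 3) * (g₂ ^ 2 * (1 - g₁) ^ 2 * (1 - g₂)) + ((1 : ℝ) / 3) * (g₂ ^ 2 * (1 - g₁) ^ 3 * (1 - g₂)) + (1 : ℝ) * (g₁ * g₂ * (1 - g₁) * (1 - g₂)) + ((1 : ℝ) / 3) * (g₁ * g₂ * (1 - g₁) ^ 2 * (1 - g₂)))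
        + ζ * ((3 : ℝ) * β₁ ^ 2 * (1 - β₁) * (1 - β₂) ^ 3) * (((1 : ℝ) / 3) * (g₁ * g₂ * (1 - g₁) * (1 - g₂)) + ((2 : ℝ) / 3) * (g₁ * g₂ * (1 - g₁) ^ 2) + ((1 : ℝ) / 3) * (g₁ * g₂ * (1 - g₁) ^ 2 * (1 - g₂)) + ((2 : ℝ) / 3) * (g₁ ^ 2 * (1 - g₁)))
        + ζ * ((3 : ℝ) * β₁ ^ 2 * (1 - β₁) * (3 : ℝ) * β₂ * (1 - β₂) ^ 2) * (((1 : ℝ) / 9) * (g₂ ^ 3 * (1 - g₁) ^ 2) + ((1 : ℝ) / 9) * (g₂ ^ 2 * (1 - g₁) ^ 3) + ((1 : ℝ) / 9) * (g₂ ^ 2 * (1 - g₁) ^ 3 * (1 - g₂)) + ((1 : ℝ) / 3) * (g₁ * g₂ * (1 - g₁) * (1 - g₂)) + ((2 : ℝ) / 3) * (g₁ * g₂ * (1 - g₁) ^ 2) + ((5 : ℝ) / 9) * (g₁ * g₂ * (1 - g₁) ^ 2 * (1 - g₂)) + ((5 : ℝ) / 9) * (g₁ ^ 2 * (1 - g₁))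 + ((1 : ℝ) / 9) * (g₁ ^ 2 * (1 - g₁) * (1 - g₂)))
        + ζ * ((3 : ℝ) * β₁ ^ 2 * (1 - β₁) * (3 : ℝ) * β₂ ^ 2 * (1 - β₂)) * (((1 : ℝ) / 3) * (g₂ ^ 2 * (1 - g₁) ^ 3) + ((1 : ℝ) / 3) * (g₂ ^ 2 * (1 - g₁) ^ 3 * (1 - g₂)) + ((5 : ℝ) / 9) * (g₁ * g₂ * (1 - g₁) * (1 - g₂)) + ((2 : ℝ) / 3) * (g₁ * g₂ * (1 - g₁) ^ 2) + ((7 : ℝ) / 9) * (g₁ * g₂ * (1 - g₁) ^ 2 * (1 - g₂)) + ((1 : ℝ) / 3) * (g₁ ^ 2 * (1 - g₁)) + ((1 : ℝ) / 3) * (g₁ ^ 2 * (1 - g₁) * (1 - g₂)))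
        + ζ * ((3 : ℝ) * β₁ ^ 2 * (1 - β₁) * β₂ ^ 3) * (((1 : ℝ) / 3) * (g₂ ^ 2 * (1 - g₁) * (1 - g₂)) + (1 : ℝ) * (g₂ ^ 2 * (1 - g₁) ^ 3 * (1 - g₂)) + ((2 : ℝ) / 3) * (g₁ * g₂ * (1 - g₁) * (1 - g₂)) + ((1 : ℝ) / 3) * (g₁ * g₂ * (1 - g₁) * (1 - g₂) ^ 2) + ((5 : ℝ) / 3) * (g₁ * g₂ * (1 - g₁) ^ 2 * (1 - g₂)) + ((2 : ℝ) / 3) * (g₁ ^ 2 * (1 - g₁) * (1 - g₂)))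
        + ζ * (β₁ ^ 3 * (1 - β₂) ^ 3) * ((1 : ℝ) * (g₁ * g₂ * (1 - g₁) * (1 - g₂)) + (2 : ℝ) * (g₁ * g₂ * (1 - g₁) ^ 2) + (1 : ℝ) * (g₁ * g₂ * (1 - g₁) ^ 2 * (1 - g₂)) + (2 : ℝ) * (g₁ ^ 2 * (1 - g₁)))
        + ζ * (β₁ ^ 3 * (3 : ℝ) * β₂ * (1 - β₂) ^ 2) * (((1 : ℝ) / 3) * (g₂ ^ 3 * (1 - g₁) ^ 2) + ((1 : ℝ) / 3) * (g₂ ^ 2 * (1 - g₁) ^ 3) + ((1 : ℝ) / 3) * (g₂ ^ 2 * (1 - g₁) ^ 3 * (1 - g₂)) + ((2 : ℝ) / 3) * (g₁ * g₂ * (1 - g₁) * (1 - g₂)) + ((5 : ℝ) / 3) * (g₁ * g₂ * (1 - g₁) ^ 2) + ((5 : ℝ) / 3) * (g₁ * g₂ * (1 - g₁) ^ 2 * (1 - g₂)) + ((4 : ℝ) / 3) * (g₁ ^ 2 * (1 - g₁)) + ((2 : ℝ) / 3) * (g₁ ^ 2 * (1 - g₁) * (1 - g₂)))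
        + ζ * (β₁ ^ 3 * (3 : ℝ) * β₂ ^ 2 * (1 - β₂)) * (((1 : ℝ) / 3) * (g₂ ^ 2 * (1 - g₁) * (1 - g₂)) + ((2 : ℝ) / 3) * (g₂ ^ 3 * (1 - g₁) ^ 2) + (1 : ℝ) * (g₂ ^ 2 * (1 - g₁) ^ 3 * (1 - g₂)) + ((1 : ℝ) / 3) * (g₁ * g₂ * (1 - g₁) * (1 - g₂) ^ 2) + ((2 : ℝ) / 3) * (g₁ * g₂ * (1 - g₁) ^ 2) + (3 : ℝ) * (g₁ * g₂ * (1 - g₁) ^ 2 * (1 - g₂)) + ((2 : ℝ) / 3) * (g₁ ^ 2 * (1 - g₁)) + ((4 : ℝ) / 3) * (g₁ ^ 2 * (1 - g₁) * (1 - g₂)))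
        + ζ * (β₁ ^ 3 * β₂ ^ 3) * ((2 : ℝ) * (g₂ ^ 2 * (1 - g₁) ^ 3 * (1 - g₂)) + (4 : ℝ) * (g₁ * g₂ * (1 - g₁) ^ 2 * (1 - g₂)) + (2 : ℝ) * (g₁ ^ 2 * (1 - g₁) * (1 - g₂))) := ⟨_, rfl⟩
  have hK1100 : 0 ≤ K110 := by rw [hK110]; positivity
  obtain ⟨K101, hK101⟩ : ∃ x : ℝ, x =
          (1 - ζ) * ((1 - β₁) ^ 3 * (3 : ℝ) * β₂ ^ 2 * (1 - β₂)) * (((1 : ℝ) / 3) * (g₂ ^ 2 * (1 - g₂)) + ((1 : ℝ) / 3) * (g₂ ^ 2 * (1 - g₁) * (1 - g₂)))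
        + (1 - ζ) * ((1 - β₁) ^ 3 * β₂ ^ 3) * ((1 : ℝ) * (g₂ ^ 2 * (1 - g₂)) + (1 : ℝ) * (g₂ ^ 2 * (1 - g₁) * (1 - g₂)))
        + (1 - ζ) * ((3 : ℝ) * β₁ * (1 - β₁) ^ 2 * (3 : ℝ) * β₂ * (1 - β₂) ^ 2) * (((1 : ℝ) / 9) * (g₁ ^ 2 * (1 - g₂)) + ((1 : ℝ) / 9) * (g₁ ^ 2 * (1 - g₂) ^ 2))
        + (1 - ζ) * ((3 : ℝ) * β₁ * (1 - β₁) ^ 2 * (3 : ℝ) * β₂ ^ 2 * (1 - β₂)) * (((1 : ℝ) / 9) * (g₂ ^ 2 * (1 - g₂)) + ((1 : ℝ) / 3) * (g₂ ^ 2 * (1 - g₁) * (1 - g₂)) + ((2 : ℝ) / 9) * (g₂ ^ 2 * (1 - g₁) ^ 2 * (1 - g₂)) + ((2 : ℝ) / 9) * (g₁ * g₂ * (1 - g₁) * (1 - g₂)) + ((1 : ℝ) / 9) * (g₁ ^ 2 * (1 - g₂)) + ((1 : ℝ) / 9) * (g₁ ^ 2 * (1 - g₂) ^ 2))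
        + (1 - ζ) * ((3 : ℝ) * β₁ * (1 - β₁) ^ 2 * β₂ ^ 3) * (((4 : ℝ) / 3) * (g₂ ^ 2 * (1 - g₁) * (1 - g₂)) + ((2 : ℝ) / 3) * (g₂ ^ 2 * (1 - g₁) ^ 2 * (1 - g₂)) + ((2 : ℝ) / 3) * (g₁ * g₂ * (1 - g₂)) + ((2 : ℝ) / 3) * (g₁ * g₂ * (1 - g₁) * (1 - g₂)))
        + (1 - ζ) * ((3 : ℝ) * β₁ ^ 2 * (1 - β₁) * (3 : ℝ) * β₂ * (1 - β₂) ^ 2) * (((1 : ℝ) / 9) * (g₁ ^ 2 * (1 - g₂) ^ 2) + ((1 : ℝ) / 9) * (g₁ ^ 2 * (1 - g₁) * (1 - g₂) ^ 2))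
        + (1 - ζ) * ((3 : ℝ) * β₁ ^ 2 * (1 - β₁) * (3 : ℝ) * β₂ ^ 2 * (1 - β₂)) * (((1 : ℝ) / 9) * (g₂ ^ 2 * (1 - g₂)) + ((1 : ℝ) / 3) * (g₂ ^ 2 * (1 - g₁) * (1 - g₂)) + ((1 : ℝ) / 9) * (g₂ ^ 2 * (1 - g₁) ^ 2 * (1 - g₂)) + ((1 : ℝ) / 9) * (g₂ ^ 2 * (1 - g₁) ^ 3 * (1 - g₂)) + ((1 : ℝ) / 9) * (g₁ * g₂ * (1 - g₂) ^ 2) + ((2 : ℝ) / 9) * (g₁ * g₂ * (1 - g₁) * (1 - g₂) ^ 2) + ((1 : ℝ) / 3) * (g₁ * g₂ * (1 - g₁) ^ 2 * (1 - g₂)) + ((2 : ℝ) / 9) * (g₁ ^ 2 * (1 - g₂) ^ 2) + ((2 : ℝ) / 9) * (g₁ ^ 2 * (1 - g₁) * (1 - g₂)))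
        + (1 - ζ) * ((3 : ℝ) * β₁ ^ 2 * (1 - β₁) * β₂ ^ 3) * (((1 : ℝ) / 3) * (g₂ ^ 2 * (1 - g₂)) + ((4 : ℝ) / 3) * (g₂ ^ 2 * (1 - g₁) ^ 2 * (1 - g₂)) + ((1 : ℝ) / 3) * (g₂ ^ 2 * (1 - g₁) ^ 3 * (1 - g₂)) + ((1 : ℝ) / 3) * (g₁ * g₂ * (1 - g₂) ^ 2) + ((4 : ℝ) / 3) * (g₁ * g₂ * (1 - g₁) * (1 - g₂)) + ((1 : ℝ) / 3) * (g₁ * g₂ * (1 - g₁) * (1 - g₂) ^ 2) + ((2 : ℝ) / 3) * (g₁ * g₂ * (1 - g₁) ^ 2 * (1 - g₂)) + ((1 : ℝ) / 3) * (g₁ ^ 2 * (1 - g₂) ^ 2) + ((1 : ℝ) / 3) * (g₁ ^ 2 * (1 - g₁) * (1 - g₂)))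
        + (1 - ζ) * (β₁ ^ 3 * (3 : ℝ) * β₂ * (1 - β₂) ^ 2) * (((1 : ℝ) / 3) * (g₁ ^ 2 * (1 - g₁) * (1 - g₂)) + ((1 : ℝ) / 3) * (g₁ ^ 2 * (1 - g₁) * (1 - g₂) ^ 2))
        + (1 - ζ) * (β₁ ^ 3 * (3 : ℝ) * β₂ ^ 2 * (1 - β₂)) * (((1 : ℝ) / 3) * (g₂ ^ 2 * (1 - g₁) ^ 2 * (1 - g₂)) + ((1 : ℝ) / 3) * (g₂ ^ 2 * (1 - g₁) ^ 3 * (1 - g₂)) + ((4 : ℝ) / 3) * (g₁ * g₂ * (1 - g₁) ^ 2 * (1 - g₂)) + (1 : ℝ) * (g₁ ^ 2 * (1 - g₁) * (1 - g₂)) + ((1 : ℝ) / 3) * (g₁ ^ 2 * (1 - g₁) * (1 - g₂) ^ 2))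
        + (1 - ζ) * (β₁ ^ 3 * β₂ ^ 3) * ((2 : ℝ) * (g₂ ^ 2 * (1 - g₁) ^ 3 * (1 - g₂)) + (4 : ℝ) * (g₁ * g₂ * (1 - g₁) ^ 2 * (1 - g₂)) + (2 : ℝ) * (g₁ ^ 2 * (1 - g₁) * (1 - g₂)))
        + ζ * ((1 - β₁) ^ 3 * (3 : ℝ) * β₂ ^ 2 * (1 - β₂)) * (((1 : ℝ) / 3) * (g₂ ^ 2 * (1 - g₂)) + ((1 : ℝ) / 3) * (g₂ ^ 2 * (1 - g₁) ^ 2 * (1 - g₂)) + ((1 : ℝ) / 3) * (g₁ * g₂ * (1 - g₂)) + ((1 : ℝ) / 3) * (g₁ * g₂ * (1 - g₂) ^ 2) + ((2 : ℝ) / 3) * (g₁ * g₂ * (1 - g₁) * (1 - g₂)))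
        + ζ * ((1 - β₁) ^ 3 * β₂ ^ 3) * ((1 : ℝ) * (g₂ ^ 2 * (1 - g₂)) + (1 : ℝ) * (g₂ ^ 2 * (1 - g₁) ^ 2 * (1 - g₂)) + (1 : ℝ) * (g₁ * g₂ * (1 - g₂)) + (1 : ℝ) * (g₁ * g₂ * (1 - g₂) ^ 2) + (2 : ℝ) * (g₁ * g₂ * (1 - g₁) * (1 - g₂)))
        + ζ * ((3 : ℝ) * β₁ * (1 - β₁) ^ 2 * (3 : ℝ) * β₂ * (1 - β₂) ^ 2) * (((1 : ℝ) / 3) * (g₁ * g₂ * (1 - g₁) * (1 - g₂)) + ((1 : ℝ) / 9) * (g₁ * g₂ * (1 - g₁) * (1 - g₂) ^ 2) + ((2 : ℝ) / 9) * (g₁ ^ 2 * (1 - g₂)))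
        + ζ * ((3 : ℝ) * β₁ * (1 - β₁) ^ 2 * (3 : ℝ) * β₂ ^ 2 * (1 - β₂)) * (((1 : ℝ) / 9) * (g₂ ^ 2 * (1 - g₂)) + ((4 : ℝ) / 9) * (g₂ ^ 2 * (1 - g₁) ^ 2 * (1 - g₂)) + ((1 : ℝ) / 9) * (g₂ ^ 2 * (1 - g₁) ^ 3 * (1 - g₂)) + ((2 : ℝ) / 9) * (g₁ * g₂ * (1 - g₂)) + ((1 : ℝ) / 9) * (g₁ * g₂ * (1 - g₂) ^ 2) + ((10 : ℝ) / 9) * (g₁ * g₂ * (1 - g₁) * (1 - g₂)) + ((1 : ℝ) / 9) * (g₁ * g₂ * (1 - g₁) ^ 2 * (1 - g₂)) + ((2 : ℝ) / 9) * (g₁ ^ 2 * (1 - g₂)))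
        + ζ * ((3 : ℝ) * β₁ * (1 - β₁) ^ 2 * β₂ ^ 3) * (((1 : ℝ) / 3) * (g₂ ^ 2 * (1 - g₂)) + ((4 : ℝ) / 3) * (g₂ ^ 2 * (1 - g₁) ^ 2 * (1 - g₂)) + ((1 : ℝ) / 3) * (g₂ ^ 2 * (1 - g₁) ^ 3 * (1 - g₂)) + ((1 : ℝ) / 3) * (g₁ * g₂ * (1 - g₂)) + ((1 : ℝ) / 3) * (g₁ * g₂ * (1 - g₂) ^ 2) + (3 : ℝ) * (g₁ * g₂ * (1 - g₁) * (1 - g₂)) + ((1 : ℝ) / 3) * (g₁ * g₂ * (1 - g₁) ^ 2 * (1 - g₂)) + ((2 : ℝ) / 3) * (g₁ ^ 2 * (1 - g₂)))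
        + ζ * ((3 : ℝ) * β₁ ^ 2 * (1 - β₁) * (3 : ℝ) * β₂ * (1 - β₂) ^ 2) * (((1 : ℝ) / 3) * (g₁ * g₂ * (1 - g₁) * (1 - g₂)) + ((1 : ℝ) / 9) * (g₁ * g₂ * (1 - g₁) * (1 - g₂) ^ 2) + ((1 : ℝ) / 9) * (g₁ * g₂ * (1 - g₁) ^ 2 * (1 - g₂)) + ((1 : ℝ) / 9) * (g₁ * g₂ * (1 - g₁) ^ 2 * (1 - g₂) ^ 2) + ((1 : ℝ) / 9) * (g₁ ^ 2 * (1 - g₂)) + ((1 : ℝ) / 9) * (g₁ ^ 2 * (1 - g₁) * (1 - g₂)))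
        + ζ * ((3 : ℝ) * β₁ ^ 2 * (1 - β₁) * (3 : ℝ) * β₂ ^ 2 * (1 - β₂)) * (((1 : ℝ) / 3) * (g₂ ^ 2 * (1 - g₂)) + ((1 : ℝ) / 3) * (g₂ ^ 2 * (1 - g₁) ^ 3 * (1 - g₂)) + ((1 : ℝ) / 3) * (g₁ * g₂ * (1 - g₂) ^ 2) + ((5 : ℝ) / 9) * (g₁ * g₂ * (1 - g₁) * (1 - g₂)) + ((4 : ℝ) / 9) * (g₁ * g₂ * (1 - g₁) * (1 - g₂) ^ 2) + ((2 : ℝ) / 3) * (g₁ * g₂ * (1 - g₁) ^ 2 * (1 - g₂)) + ((1 : ℝ) / 3) * (g₁ ^ 2 * (1 - g₂) ^ 2) + ((1 : ℝ) / 3) * (g₁ ^ 2 * (1 - g₁) * (1 - g₂)))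
        + ζ * ((3 : ℝ) * β₁ ^ 2 * (1 - β₁) * β₂ ^ 3) * (((2 : ℝ) / 3) * (g₂ ^ 2 * (1 - g₂)) + ((1 : ℝ) / 3) * (g₂ ^ 2 * (1 - g₁) * (1 - g₂)) + (1 : ℝ) * (g₂ ^ 2 * (1 - g₁) ^ 3 * (1 - g₂)) + ((2 : ℝ) / 3) * (g₁ * g₂ * (1 - g₂) ^ 2) + ((2 : ℝ) / 3) * (g₁ * g₂ * (1 - g₁) * (1 - g₂)) + (1 : ℝ) * (g₁ * g₂ * (1 - g₁) * (1 - g₂) ^ 2) + ((5 : ℝ) / 3) * (g₁ * g₂ * (1 - g₁) ^ 2 * (1 - g₂)) + ((2 : ℝ) / 3) * (g₁ ^ 2 * (1 - g₂) ^ 2) + ((2 : ℝ) / 3) * (g₁ ^ 2 * (1 - g₁) * (1 - g₂)))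
        + ζ * (β₁ ^ 3 * (3 : ℝ) * β₂ * (1 - β₂) ^ 2) * (((1 : ℝ) / 3) * (g₁ * g₂ * (1 - g₁) * (1 - g₂)) + ((2 : ℝ) / 3) * (g₁ * g₂ * (1 - g₁) ^ 2 * (1 - g₂)) + ((1 : ℝ) / 3) * (g₁ * g₂ * (1 - g₁) ^ 2 * (1 - g₂) ^ 2) + ((2 : ℝ) / 3) * (g₁ ^ 2 * (1 - g₁) * (1 - g₂)))
        + ζ * (β₁ ^ 3 * (3 : ℝ) * β₂ ^ 2 * (1 - β₂)) * (((1 : ℝ) / 3) * (g₂ ^ 2 * (1 - g₁) * (1 - g₂)) + ((1 : ℝ) / 3) * (g₂ ^ 2 * (1 - g₁) ^ 3 * (1 - g₂)) + ((1 : ℝ) / 3) * (g₁ * g₂ * (1 - g₁) * (1 - g₂) ^ 2) + ((5 : ℝ) / 3) * (g₁ * g₂ * (1 - g₁) ^ 2 * (1 - g₂)) + ((2 : ℝ) / 3) * (g₁ * g₂ * (1 - g₁) ^ 2 * (1 - g₂) ^ 2) + ((4 : ℝ) / 3) * (g₁ ^ 2 * (1 - g₁) * (1 - g₂)))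
        + ζ * (β₁ ^ 3 * β₂ ^ 3) * ((2 : ℝ) * (g₂ ^ 2 * (1 - g₁) ^ 3 * (1 - g₂)) + (4 : ℝ) * (g₁ * g₂ * (1 - g₁) ^ 2 * (1 - g₂)) + (2 : ℝ) * (g₁ ^ 2 * (1 - g₁) * (1 - g₂))) := ⟨_, rfl⟩
  have hK1010 : 0 ≤ K101 := by rw [hK101]; positivity
  obtain ⟨K011, hK011⟩ : ∃ x : ℝ, x =
          (1 - ζ) * ((3 : ℝ) * β₁ * (1 - β₁) ^ 2 * (3 : ℝ) * β₂ * (1 - β₂) ^ 2) * (((1 : ℝ) / 9) * (g₂ ^ 2 * (1 - g₁)) + ((1 : ℝ) / 9) * (g₁ ^ 2 * (1 - g₂)) + ((1 : ℝ) / 9) * ((g₁ - g₂) ^ 2))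
        + (1 - ζ) * ((3 : ℝ) * β₁ * (1 - β₁) ^ 2 * (3 : ℝ) * β₂ ^ 2 * (1 - β₂)) * (((1 : ℝ) / 9) * (g₂ ^ 2 * (1 - g₁) * (1 - g₂)) + ((2 : ℝ) / 9) * (g₁ ^ 2 * (1 - g₂)) + ((1 : ℝ) / 9) * (g₁ ^ 2 * (1 - g₂) ^ 2) + ((1 : ℝ) / 9) * ((g₁ - g₂) ^ 2))
        + (1 - ζ) * ((3 : ℝ) * β₁ * (1 - β₁) ^ 2 * β₂ ^ 3) * (((2 : ℝ) / 3) * (g₂ ^ 2 * (1 - g₁) * (1 - g₂)) + ((1 : ℝ) / 3) * (g₁ ^ 2 * (1 - g₂)) + ((1 : ℝ) / 3) * (g₁ ^ 2 * (1 - g₂) ^ 2))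
        + (1 - ζ) * ((3 : ℝ) * β₁ ^ 2 * (1 - β₁) * (3 : ℝ) * β₂ * (1 - β₂) ^ 2) * (((2 : ℝ) / 9) * (g₂ ^ 2 * (1 - g₁)) + ((1 : ℝ) / 9) * (g₂ ^ 2 * (1 - g₁) ^ 2) + ((1 : ℝ) / 9) * (g₁ ^ 2 * (1 - g₁) * (1 - g₂)) + ((1 : ℝ) / 9) * ((g₁ - g₂) ^ 2))
        + (1 - ζ) * ((3 : ℝ) * β₁ ^ 2 * (1 - β₁) * (3 : ℝ) * β₂ ^ 2 * (1 - β₂)) * (((1 : ℝ) / 9) * (g₂ ^ 2 * (1 - g₁) * (1 - g₂)) + ((1 : ℝ) / 9) * (g₂ ^ 2 * (1 - g₁) ^ 2) + ((1 : ℝ) / 9) * (g₂ ^ 2 * (1 - g₁) ^ 2 * (1 - g₂)) + ((1 : ℝ) / 9) * (g₂ ^ 2 * (1 - g₁) ^ 3) + ((2 : ℝ) / 9) * (g₁ * g₂ * (1 - g₁) ^ 2) + ((1 : ℝ) / 9) * (g₁ ^ 2 * (1 - g₂)) + ((1 : ℝ) / 9) * (g₁ ^ 2 * (1 - g₂) ^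 2) + ((1 : ℝ) / 9) * (g₁ ^ 2 * (1 - g₁)) + ((1 : ℝ) / 9) * (g₁ ^ 2 * (1 - g₁) * (1 - g₂)))
        + (1 - ζ) * ((3 : ℝ) * β₁ ^ 2 * (1 - β₁) * β₂ ^ 3) * (((1 : ℝ) / 3) * (g₂ ^ 2 * (1 - g₂)) + (1 : ℝ) * (g₂ ^ 2 * (1 - g₁) ^ 2 * (1 - g₂)) + ((1 : ℝ) / 3) * (g₁ * g₂ * (1 - g₂) ^ 2) + ((1 : ℝ) / 3) * (g₁ * g₂ * (1 - g₁) * (1 - g₂)) + ((1 : ℝ) / 3) * (g₁ * g₂ * (1 - g₁) * (1 - g₂) ^ 2) + ((1 : ℝ) / 3) * (g₁ * g₂ * (1 - g₁) ^ 2 * (1 - g₂)) + ((1 : ℝ) / 3) * (g₁ ^ 2 * (1 - g₂) ^ 2) + ((1 : ℝ) / 3) * (g₁ ^ 2 * (1 - g₁) * (1 - g₂)))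
        + (1 - ζ) * (β₁ ^ 3 * (3 : ℝ) * β₂ * (1 - β₂) ^ 2) * (((1 : ℝ) / 3) * (g₂ ^ 2 * (1 - g₁)) + ((1 : ℝ) / 3) * (g₂ ^ 2 * (1 - g₁) ^ 2) + ((2 : ℝ) / 3) * (g₁ ^ 2 * (1 - g₁) * (1 - g₂)))
        + (1 - ζ) * (β₁ ^ 3 * (3 : ℝ) * β₂ ^ 2 * (1 - β₂)) * (((1 : ℝ) / 3) * (g₂ ^ 2 * (1 - g₁)) + ((1 : ℝ) / 3) * (g₂ ^ 2 * (1 - g₁) ^ 2 * (1 - g₂)) + ((4 : ℝ) / 3) * (g₁ * g₂ * (1 - g₁) ^ 2 * (1 - g₂)) + ((4 : ℝ) / 3) * (g₁ ^ 2 * (1 - g₁) * (1 - g₂)))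
        + (1 - ζ) * (β₁ ^ 3 * β₂ ^ 3) * ((2 : ℝ) * (g₂ ^ 2 * (1 - g₁) ^ 3 * (1 - g₂)) + (4 : ℝ) * (g₁ * g₂ * (1 - g₁) ^ 2 * (1 - g₂)) + (2 : ℝ) * (g₁ ^ 2 * (1 - g₁) * (1 - g₂)))
        + ζ * ((3 : ℝ) * β₁ * (1 - β₁) ^ 2 * (3 : ℝ) * β₂ * (1 - β₂) ^ 2) * (((2 : ℝ) / 9) * (g₂ ^ 2 * (1 - g₁) ^ 2) + ((2 : ℝ) / 9) * (g₁ * g₂ * (1 - g₁)) + ((2 : ℝ) / 9) * (g₁ ^ 2 * (1 - g₂)))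
        + ζ * ((3 : ℝ) * β₁ * (1 - β₁) ^ 2 * (3 : ℝ) * β₂ ^ 2 * (1 - β₂)) * (((1 : ℝ) / 9) * (g₂ ^ 2 * (1 - g₁)) + ((1 : ℝ) / 9) * (g₂ ^ 2 * (1 - g₁) ^ 2 * (1 - g₂)) + ((4 : ℝ) / 9) * (g₁ * g₂ * (1 - g₁) * (1 - g₂)) + ((4 : ℝ) / 9) * (g₁ ^ 2 * (1 - g₂)))
        + ζ * ((3 : ℝ) * β₁ * (1 - β₁) ^ 2 * β₂ ^ 3) * (((2 : ℝ) / 3) * (g₂ ^ 2 * (1 - g₁) ^ 2 * (1 - g₂)) + ((4 : ℝ) / 3) * (g₁ * g₂ * (1 - g₁) * (1 - g₂)) + ((2 : ℝ) / 3) * (g₁ ^ 2 * (1 - g₂)))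
        + ζ * ((3 : ℝ) * β₁ ^ 2 * (1 - β₁) * (3 : ℝ) * β₂ * (1 - β₂) ^ 2) * (((1 : ℝ) / 9) * (g₂ ^ 2 * (1 - g₁)) + ((2 : ℝ) / 9) * (g₂ ^ 2 * (1 - g₁) ^ 2) + ((1 : ℝ) / 9) * (g₂ ^ 2 * (1 - g₁) ^ 3) + ((2 : ℝ) / 9) * (g₁ * g₂ * (1 - g₁)) + ((2 : ℝ) / 9) * (g₁ * g₂ * (1 - g₁) ^ 2) + ((1 : ℝ) / 9) * (g₁ ^ 2 * (1 - g₂)) + ((1 : ℝ) / 9) * (g₁ ^ 2 * (1 - g₁)))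
        + ζ * ((3 : ℝ) * β₁ ^ 2 * (1 - β₁) * (3 : ℝ) * β₂ ^ 2 * (1 - β₂)) * (((1 : ℝ) / 3) * (g₂ ^ 2 * (1 - g₁) ^ 2 * (1 - g₂)) + ((1 : ℝ) / 3) * (g₂ ^ 2 * (1 - g₁) ^ 3) + ((4 : ℝ) / 9) * (g₁ * g₂ * (1 - g₁) * (1 - g₂)) + ((2 : ℝ) / 3) * (g₁ * g₂ * (1 - g₁) ^ 2) + ((1 : ℝ) / 3) * (g₁ ^ 2 * (1 - g₂)) + ((1 : ℝ) / 3) * (g₁ ^ 2 * (1 - g₁)))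
        + ζ * ((3 : ℝ) * β₁ ^ 2 * (1 - β₁) * β₂ ^ 3) * (((2 : ℝ) / 3) * (g₂ ^ 2 * (1 - g₂)) + ((2 : ℝ) / 3) * (g₂ ^ 2 * (1 - g₁) ^ 3 * (1 - g₂)) + ((2 : ℝ) / 3) * (g₁ * g₂ * (1 - g₂) ^ 2) + ((2 : ℝ) / 3) * (g₁ * g₂ * (1 - g₁) * (1 - g₂) ^ 2) + ((4 : ℝ) / 3) * (g₁ * g₂ * (1 - g₁) ^ 2 * (1 - g₂)) + ((2 : ℝ) / 3) * (g₁ ^ 2 * (1 - g₂) ^ 2) + ((2 : ℝ) / 3) * (g₁ ^ 2 * (1 - g₁) * (1 - g₂)))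
        + ζ * (β₁ ^ 3 * (3 : ℝ) * β₂ * (1 - β₂) ^ 2) * (((2 : ℝ) / 3) * (g₂ ^ 2 * (1 - g₁) ^ 3) + ((4 : ℝ) / 3) * (g₁ * g₂ * (1 - g₁) ^ 2) + ((2 : ℝ) / 3) * (g₁ ^ 2 * (1 - g₁)))
        + ζ * (β₁ ^ 3 * (3 : ℝ) * β₂ ^ 2 * (1 - β₂)) * (((2 : ℝ) / 3) * (g₂ ^ 2 * (1 - g₁) ^ 3) + ((2 : ℝ) / 3) * (g₂ ^ 2 * (1 - g₁) ^ 3 * (1 - g₂)) + ((4 : ℝ) / 3) * (g₁ * g₂ * (1 - g₁) ^ 2) + ((4 : ℝ) / 3) * (g₁ * g₂ * (1 - g₁) ^ 2 * (1 - g₂)) + ((2 : ℝ) / 3) * (g₁ ^ 2 * (1 - g₁)) + ((2 : ℝ) / 3) * (g₁ ^ 2 * (1 - g₁) * (1 - g₂)))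
        + ζ * (β₁ ^ 3 * β₂ ^ 3) * ((2 : ℝ) * (g₂ ^ 2 * (1 - g₁) ^ 3 * (1 - g₂)) + (4 : ℝ) * (g₁ * g₂ * (1 - g₁) ^ 2 * (1 - g₂)) + (2 : ℝ) * (g₁ ^ 2 * (1 - g₁) * (1 - g₂))) := ⟨_, rfl⟩
  have hK0110 : 0 ≤ K011 := by rw [hK011]; positivity
  have key : 2 * ((β₁ * (1 - β₂)) * (1 - g₁) * (τ + p₁ - g₂ * τ) + ((1 - β₁) * β₂) * (1 - g₂) * (τ + p₂ - g₁ * τ) + (β₁ * β₂) * (1 - g₁) * (1 - g₂) * (τ + p₁ + p₂)) * ((β₁ * (1 - β₂)) * g₁ * (τ + p₁) + ((1 - β₁) * β₂) * g₂ * (τ + p₂) + (β₁ * β₂) * (1 - (1 - g₁) * (1 - g₂)) * (τ + p₁ + p₂))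
      - ((β₁ * (1 - β₂)) * (1 - g₁) * (τ + p₁ - g₂ * τ) * g₁ * (1 - g₂ * ζ) + ((1 - β₁) * β₂) * (1 - g₂) * (τ + p₂ - g₁ * τ) * g₂ * (1 - g₁ * ζ) + (β₁ * β₂) * (1 - g₁) * (1 - g₂) * (τ + p₁ + p₂) * (1 - (1 - g₁) * (1 - g₂)) + ((β₁ * β₂) * ((1 - g₁) * g₂ * p₁ + g₁ * (1 - g₂) * p₂) * (((1 - β₁) * (1 - β₂)) * (1 - (1 - g₁) * (1 - g₂)) + (1 - ζ) * ((β₁ * (1 - β₂)) * (1 - g₁) * g₂ + ((1 - β₁) * β₂) * (1 - g₂) * g₁))))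
        * (((β₁ * (1 - β₂)) * (τ + p₁) + ((1 - β₁) * β₂) * (τ + p₂) + (β₁ * β₂) * (τ + p₁ + p₂))
           + ((β₁ * (1 - β₂)) * (1 - g₁) * (τ + p₁) + ((1 - β₁) * β₂) * (1 - g₂) * (τ + p₂) + (β₁ * β₂) * (1 - g₁) * (1 - g₂) * (τ + p₁ + p₂)))
      = τ ^ 2 * K200 + p₁ ^ 2 * K020 + p₂ ^ 2 * K002 + τ * p₁ * K110 + τ * p₂ * K101 + p₁ * p₂ * K011 := by
    rw [hK200, hK020, hK002, hK110, hK101, hK011]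
    ring
  rw [key]
  positivity

set_option maxRecDepth 4096 in
set_option maxHeartbeats 800000 in
/-- **THEOREM F** (memo §0–§2; cell level).  Let `G_a` be any finite weighted graph containing `a, y, z`, with three-point law
`τ = P(a~y~z)`, `p₁ = P(a~y only)`, `p₂ = P(a~z only)`, `ζ = P(y~z)`; let `H = G_a ∪ {b–y (β₁), b–z (β₂)}` and let the hub `c` be joined
to `y` (weight `g₁`) and `z` (weight `g₂`).  If the single-hub readings `(G_a; a, y; hub at z)` and `(G_a; a, z; hub at y)` satisfy
`Cov ≤ w·log(θ/w)` (`hL₁`, `hL₂`, with their cells `θ(N₁) = τ+p₁`, `w(N₁) = τ+p₁−g₂τ`, `Cov(N₁) = g₂τ − g₂²(τ+p₂)ζ`, symmetrically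
for `N₂`), then so does `(H; a, b)` with the hub `c`: `z − u·v ≤ w·log(θ/w)` where `u = P(a≁c)`, `v = P(b≁c)`, `z = P(a≁c, b≁c)`,
`θ = P(a ~_H b)`, `w = P(a ~_H b, a≁c)` are the composite's cells (`hu, hv, hz, hθ, hw`). -/
theorem fan2cut_cov_le {τ p₁ p₂ ζ g₁ g₂ β₁ β₂ : ℝ}
    (hτ : 0 ≤ τ) (hp₁ : 0 ≤ p₁) (hp₂ : 0 ≤ p₂) (hA₁ : 0 < τ + p₁) (hA₂ : 0 < τ + p₂) (hζ : 0 ≤ ζ) (hζ1 : ζ ≤ 1)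
    (hg₁ : 0 ≤ g₁) (hg₁1 : g₁ < 1) (hg₂ : 0 ≤ g₂) (hg₂1 : g₂ < 1)
    (hβ₁ : 0 < β₁) (hβ₁1 : β₁ < 1) (hβ₂ : 0 < β₂) (hβ₂1 : β₂ < 1)
    (hL₁ : g₂ * τ - g₂ ^ 2 * (τ + p₂) * ζ ≤ (τ + p₁ - g₂ * τ) * Real.log ((τ + p₁) / (τ + p₁ - g₂ * τ)))
    (hL₂ : g₁ * τ - g₁ ^ 2 * (τ + p₁) * ζ ≤ (τ + p₂ - g₁ * τ) * Real.log ((τ + p₂) / (τ + p₂ - g₁ * τ)))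
    {u v z θ w : ℝ}
    (hu : u = (τ * (1 - g₁) * (1 - g₂) + p₁ * (1 - g₁) * (1 - g₂ * β₁ * β₂) + p₂ * (1 - g₂) * (1 - g₁ * β₁ * β₂) + (1 - τ - p₁ - p₂)))
    (hv : v = ((β₁ * β₂) * (1 - g₁) * (1 - g₂) + (β₁ * (1 - β₂)) * (1 - g₁) * (1 - g₂ * ζ) + ((1 - β₁) * β₂) * (1 - g₂) * (1 - g₁ * ζ) + ((1 - β₁) * (1 - β₂))))
    (hz : z = (τ * (1 - g₁) * (1 - g₂) + p₁ * (1 - g₁) * (1 - β₂ * g₂) + p₂ * (1 - g₂) * (1 - β₁ * g₁) + (ζ - τ) * ((1 - ((1 - β₁) * (1 - β₂))) * (1 - g₁) * (1 - g₂) + ((1 - β₁) * (1 - β₂))) + (1 - p₁ - p₂ - ζ) * (1 - β₁ * g₁) * (1 - β₂ * g₂)))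
    (hθ : θ = ((β₁ * (1 - β₂)) * (τ + p₁) + ((1 - β₁) * β₂) * (τ + p₂) + (β₁ * β₂) * (τ + p₁ + p₂)))
    (hw : w = ((β₁ * (1 - β₂)) * (1 - g₁) * (τ + p₁ - g₂ * τ) + ((1 - β₁) * β₂) * (1 - g₂) * (τ + p₂ - g₁ * τ) + (β₁ * β₂) * (1 - g₁) * (1 - g₂) * (τ + p₁ + p₂))) :
    z - u * v ≤ w * Real.log (θ / w) := by
  have hc₁ : 0 < 1 - g₁ := by linarith
  have hc₂ : 0 < 1 - g₂ := by linarith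
  have hb₁ : 0 < 1 - β₁ := by linarith
  have hb₂ : 0 < 1 - β₂ := by linarith
  have hA : 0 < τ + p₁ + p₂ := by linarith
  -- the masses of the three key-unmarked classes and their connection masses
  obtain ⟨m₁, hm₁⟩ : ∃ x : ℝ, x = (β₁ * (1 - β₂)) * (1 - g₁) * (τ + p₁ - g₂ * τ) := ⟨_, rfl⟩
  obtain ⟨m₂, hm₂⟩ : ∃ x : ℝ, x = ((1 - β₁) * β₂) * (1 - g₂) * (τ + p₂ - g₁ * τ) := ⟨_, rfl⟩
  obtain ⟨m₁₂, hm₁₂⟩ : ∃ x : ℝ, x = (β₁ * β₂) * (1 - g₁) * (1 - g₂) * (τ + p₁ + p₂) := ⟨_, rfl⟩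
  obtain ⟨P₁, hP₁⟩ : ∃ x : ℝ, x = (β₁ * (1 - β₂)) * (1 - g₁) * (τ + p₁) := ⟨_, rfl⟩
  obtain ⟨P₂, hP₂⟩ : ∃ x : ℝ, x = ((1 - β₁) * β₂) * (1 - g₂) * (τ + p₂) := ⟨_, rfl⟩
  obtain ⟨θp, hθp⟩ : ∃ x : ℝ, x = ((β₁ * (1 - β₂)) * (1 - g₁) * (τ + p₁) + ((1 - β₁) * β₂) * (1 - g₂) * (τ + p₂) + (β₁ * β₂) * (1 - g₁) * (1 - g₂) * (τ + p₁ + p₂)) := ⟨_, rfl⟩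
  obtain ⟨Np, hNp⟩ : ∃ x : ℝ, x = ((β₁ * (1 - β₂)) * g₁ * (τ + p₁) + ((1 - β₁) * β₂) * g₂ * (τ + p₂) + (β₁ * β₂) * (1 - (1 - g₁) * (1 - g₂)) * (τ + p₁ + p₂)) := ⟨_, rfl⟩
  obtain ⟨R, hR⟩ : ∃ x : ℝ, x = ((β₁ * (1 - β₂)) * (1 - g₁) * (τ + p₁ - g₂ * τ) * g₁ * (1 - g₂ * ζ) + ((1 - β₁) * β₂) * (1 - g₂) * (τ + p₂ - g₁ * τ) * g₂ * (1 - g₁ * ζ) + (β₁ * β₂) * (1 - g₁) * (1 - g₂) * (τ + p₁ + p₂) * (1 - (1 - g₁) * (1 - g₂)) + ((β₁ * β₂) * ((1 - g₁) * g₂ * p₁ + g₁ * (1 - g₂) * p₂) * (((1 - β₁) * (1 - β₂)) * (1 - (1 - g₁) * (1 - g₂)) + (1 - ζ) * ((β₁ * (1 - β₂)) * (1 - g₁) * g₂ + ((1 - β₁) * β₂) * (1 - g₂) * g₁)))) := ⟨_, rfl⟩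
  have hw₁ : 0 < τ + p₁ - g₂ * τ := by
    have e1 : τ + p₁ - g₂ * τ = (1 - g₂) * (τ + p₁) + g₂ * p₁ := by ring
    rw [e1]; positivity
  have hw₂ : 0 < τ + p₂ - g₁ * τ := by
    have e1 : τ + p₂ - g₁ * τ = (1 - g₁) * (τ + p₂) + g₁ * p₂ := by ring
    rw [e1]; positivity
  have hm₁0 : 0 < m₁ := by rw [hm₁]; positivity
  have hm₂0 : 0 < m₂ := by rw [hm₂]; positivity
  have hm₁₂0 : 0 < m₁₂ := by rw [hm₁₂]; positivity
  have hP₁0 : 0 < P₁ := by rw [hP₁]; positivity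
  have hP₂0 : 0 < P₂ := by rw [hP₂]; positivity
  have hw0 : 0 < w := by
    have e : w = m₁ + m₂ + m₁₂ := by rw [hw, hm₁, hm₂, hm₁₂]
    rw [e]; positivity
  have hθp0 : 0 < θp := by
    have e : θp = P₁ + P₂ + m₁₂ := by rw [hθp, hP₁, hP₂, hm₁₂]
    rw [e]; positivity
  have hNp0 : 0 ≤ Np := by
    rw [hNp]
    have h1 : 0 ≤ 1 - (1 - g₁) * (1 - g₂) := by
      have e1 : 1 - (1 - g₁) * (1 - g₂) = g₁ + (1 - g₁) * g₂ := by ring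
      rw [e1]; positivity
    positivity
  have hθe : θ = θp + Np := by rw [hθ, hθp, hNp]; ring
  have hθ0 : 0 < θ := by rw [hθe]; linarith
  -- (E1) key-mark merging + log-sum (twice)
  have hls1 := GZWheatstonePlus.logsum2 hm₁0 hm₂0 hP₁0 hP₂0
  have hls2 := GZWheatstonePlus.logsum2 (add_pos hm₁0 hm₂0) hm₁₂0 (add_pos hP₁0 hP₂0) hm₁₂0
  have e12 : m₁₂ * Real.log (m₁₂ / m₁₂) = 0 := by rw [div_self hm₁₂0.ne', Real.log_one, mul_zero]
  have ew : m₁ + m₂ + m₁₂ = w := by rw [hw, hm₁, hm₂, hm₁₂]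
  have eθp : P₁ + P₂ + m₁₂ = θp := by rw [hθp, hP₁, hP₂, hm₁₂]
  rw [e12, add_zero, ew, eθp] at hls2
  -- hls2 : (m₁+m₂) log((P₁+P₂)/(m₁+m₂)) ≤ w log(θp/w);  hls1 : m₁ log(P₁/m₁) + m₂ log(P₂/m₂) ≤ (m₁+m₂) log((P₁+P₂)/(m₁+m₂))
  -- (E2) the readings: f₁c₁·Cov(N₁) ≤ m₁ log(P₁/m₁), f₂c₂·Cov(N₂) ≤ m₂ log(P₂/m₂)
  have hf₁ : 0 ≤ (β₁ * (1 - β₂)) * (1 - g₁) := by positivity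
  have hf₂ : 0 ≤ ((1 - β₁) * β₂) * (1 - g₂) := by positivity
  have er₁ : P₁ / m₁ = (τ + p₁) / (τ + p₁ - g₂ * τ) := by
    rw [hP₁, hm₁]; field_simp
  have er₂ : P₂ / m₂ = (τ + p₂) / (τ + p₂ - g₁ * τ) := by
    rw [hP₂, hm₂]; field_simp
  have hR₁ : (β₁ * (1 - β₂)) * (1 - g₁) * (g₂ * τ - g₂ ^ 2 * (τ + p₂) * ζ) ≤ m₁ * Real.log (P₁ / m₁) := by
    rw [er₁, hm₁, mul_assoc ((β₁ * (1 - β₂)) * (1 - g₁))]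
    exact mul_le_mul_of_nonneg_left hL₁ hf₁
  have hR₂ : ((1 - β₁) * β₂) * (1 - g₂) * (g₁ * τ - g₁ ^ 2 * (τ + p₁) * ζ) ≤ m₂ * Real.log (P₂ / m₂) := by
    rw [er₂, hm₂, mul_assoc (((1 - β₁) * β₂) * (1 - g₂))]
    exact mul_le_mul_of_nonneg_left hL₂ hf₂
  -- (E2') the covariance identity
  have ecov : z - u * v = (β₁ * (1 - β₂)) * (1 - g₁) * (g₂ * τ - g₂ ^ 2 * (τ + p₂) * ζ) + ((1 - β₁) * β₂) * (1 - g₂) * (g₁ * τ - g₁ ^ 2 * (τ + p₁) * ζ) + R := by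
    rw [hz, hu, hv, hR]; ring
  -- (E3) Padé: θp·log(θ/θp) ≥ 2 θp Np/(θ+θp), hence w·log(θ/θp) ≥ 2 w Np/(θ+θp)
  have hpade := GZParallel.two_mul_mul_le_mul_log hθp0 hNp0
  have eθ' : (θp + Np) / θp = θ / θp := by rw [hθe]
  rw [eθ'] at hpade
  -- hpade : 2 θp Np ≤ (2 θp + Np) (θp log(θ/θp))
  have hD : 0 < θ + θp := by linarith
  have hE3 : w * (2 * Np) ≤ w * ((θ + θp) * Real.log (θ / θp)) := by
    have h2 : θp * (2 * Np) ≤ θp * ((θ + θp) * Real.log (θ / θp)) := by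
      have e1 : θp * (2 * Np) = 2 * θp * Np := by ring
      have e2 : θp * ((θ + θp) * Real.log (θ / θp)) = (2 * θp + Np) * (θp * Real.log (θ / θp)) := by
        rw [hθe]; ring
      rw [e1, e2]; exact hpade
    have h1 : 2 * Np ≤ (θ + θp) * Real.log (θ / θp) := le_of_mul_le_mul_left h2 hθp0
    exact mul_le_mul_of_nonneg_left h1 hw0.le
  -- (E4) the polynomial inequality: R (θ+θp) ≤ 2 w Np
  have hpoly : 0 ≤ 2 * w * Np - R * (θ + θp) := by
    have h := poly_nonneg hτ hp₁ hp₂ hζ hζ1 hg₁ hg₁1.le hg₂ hg₂1.le hβ₁.le hβ₁1.le hβ₂.le hβ₂1.le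
    have e : 2 * w * Np - R * (θ + θp) = 2 * ((β₁ * (1 - β₂)) * (1 - g₁) * (τ + p₁ - g₂ * τ) + ((1 - β₁) * β₂) * (1 - g₂) * (τ + p₂ - g₁ * τ) + (β₁ * β₂) * (1 - g₁) * (1 - g₂) * (τ + p₁ + p₂)) * ((β₁ * (1 - β₂)) * g₁ * (τ + p₁) + ((1 - β₁) * β₂) * g₂ * (τ + p₂) + (β₁ * β₂) * (1 - (1 - g₁) * (1 - g₂)) * (τ + p₁ + p₂)) - ((β₁ * (1 - β₂)) * (1 - g₁) * (τ + p₁ - g₂ * τ) * g₁ * (1 - g₂ * ζ) + ((1 - β₁) * β₂) * (1 - g₂) * (τ + p₂ - g₁ * τ) * g₂ * (1 - g₁ * ζ) + (β₁ * β₂) * (1 - g₁) * (1 - g₂) * (τ + p₁ + p₂) * (1 - (1 - g₁) * (1 - g₂)) + ((β₁ * β₂) * ((1 - g₁) * g₂ * p₁ + g₁ * (1 - g₂) * p₂) * (((1 - β₁) * (1 - β₂)) * (1 - (1 - g₁) * (1 - g₂)) + (1 - ζ) * ((β₁ * (1 - β₂)) * (1 - g₁) * g₂ + ((1 - β₁)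 * β₂) * (1 - g₂) * g₁)))) * (((β₁ * (1 - β₂)) * (τ + p₁) + ((1 - β₁) * β₂) * (τ + p₂) + (β₁ * β₂) * (τ + p₁ + p₂)) + ((β₁ * (1 - β₂)) * (1 - g₁) * (τ + p₁) + ((1 - β₁) * β₂) * (1 - g₂) * (τ + p₂) + (β₁ * β₂) * (1 - g₁) * (1 - g₂) * (τ + p₁ + p₂))) := by
      rw [hw, hNp, hR, hθ, hθp]
    rw [e]; exact h
  have hE4 : (θ + θp) * R ≤ (θ + θp) * (w * Real.log (θ / θp)) := by linarith [hpoly, hE3]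
  have hRle : R ≤ w * Real.log (θ / θp) := le_of_mul_le_mul_left hE4 hD
  -- assemble: log(θ/w) = log(θp/w) + log(θ/θp)
  have elog : w * Real.log (θ / w) = w * Real.log (θp / w) + w * Real.log (θ / θp) := by
    rw [Real.log_div hθ0.ne' hw0.ne', Real.log_div hθp0.ne' hw0.ne', Real.log_div hθ0.ne' hθp0.ne']; ring
  rw [elog, ecov]
  linarith [hls1, hls2, hR₁, hR₂, hRle]

end GZFanTwoCut

end Summit.CriticalPhenomena.PercolationContinuityZ3.Theorems
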